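import Summits.QuantumAdvantage.QuantumAdvantage.Theorems.MobiusLadderLiouvilleOrthogonalTC0StubPeresTail
import Summits.QuantumAdvantage.QuantumAdvantage.Theorems.MobiusLadderLiouvilleOrthogonalTC0StubLtfInfluence
import Summits.QuantumAdvantage.QuantumAdvantage.Theorems.MobiusLadderLiouvilleOrthogonalTC0StubLtfCore
import HarnessLib

/-!
# Crux `MobiusLadder.LiouvilleOrthogonalTC0` (stmt-QuantumAdvantage-1393), line `Sketch`: block
sensitivity of threshold functions and Peres' conclusion with a multiplicity constant

Two reusable forms of the ingredients of the depth-one rung (skeleton v4), prepared for the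
bounded-size rung (skeleton v5: circuits over `tcBasis` with a bounded number of gates compute Boolean
combinations of boundedly many threshold functions, whose block sensitivities add up):

* `SensLtf.tailWeight_le_of_sens_mul` — Peres' conclusion with a constant: if for every `m`-partition
  `π` of the variables the number of pairs (point, sensitive block) of `f` is `≤ B · 2ⁿ √m`, then
  `W^{≥ m}[sgn ∘ f] ≤ 3B/√m` (`m ≥ 10`) — the proof of `StubPeresTail.tailWeight_le_of_sens` verbatim
  with the constant carried along;
* `SensLtf.sens_ltf_le`, `SensLtf.sens_intLtf_le` — the block sensitivity of a (real or integer) linear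
  threshold function is `≤ 2ⁿ √m` for EVERY partition `π` (the heart of Peres' argument:
  `StubPeresTail.ltf_translate`, `StubPeresTail.sum_le_of_translates`, `stub_ltfInfluence`).

Registered stubs `stub_tailOfSens`, `stub_sensLtf` (verbatim wrappers at the end).
-/

set_option linter.dupNamespace false -- D-0017: single-problem summit ⇒ `QuantumAdvantage.QuantumAdvantage` by design

noncomputable section

namespace Summit.QuantumAdvantage.QuantumAdvantage.Theorems.LiouvilleOrthogonalTC0

open Finset
open Literature.Computability.Complexity.LowDegree (tailWeight cubeFourierCoeff tailWeight_le_one)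
open Literature.Probability.RandomGraphs.LowDegree (sgn)

namespace SensLtf

variable {n m : ℕ}

open StubPeresTail in
/-- **Peres' conclusion with a multiplicity constant.** If for every partition `π : Fin n → Fin m`
the number of pairs (point, sensitive block) of `f` is at most `B · 2ⁿ √m`, then
`W^{≥ m}[sgn ∘ f] ≤ 3B/√m` (`m ≥ 10`). -/
theorem tailWeight_le_of_sens_mul (hm : 10 ≤ m) {B : ℝ} (f : (Fin n → Bool) → Bool)
    (hδ : ∀ π : Fin n → Fin m, ∑ x : Fin n → Bool,
      ((univ.filter fun j : Fin m => f x ≠ f (fun i => xor (x i) (decide (π i = j)))).card : ℝ)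
        ≤ B * (2 ^ n * Real.sqrt m)) :
    tailWeight (fun x => sgn (f x)) m ≤ 3 * B / Real.sqrt m := by
  have hm1 : 1 ≤ m := by omega
  have hmpos : (0 : ℝ) < m := Nat.cast_pos.2 (by omega)
  have hm2 : (2 : ℝ) ≤ m := by exact_mod_cast (show 2 ≤ m by omega)
  have hρ0 : (0 : ℝ) ≤ 1 - 2 / m := by
    rw [sub_nonneg, div_le_one hmpos]
    exact hm2
  have hρ1 : 1 - 2 / (m : ℝ) ≤ 1 := by
    have : (0 : ℝ) ≤ 2 / m := by positivity
    linarith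
  have hρm : (1 - 2 / (m : ℝ)) ^ m ≤ 1 / 3 := one_sub_div_pow_le_third (by omega)
  have hs : Real.sqrt m * Real.sqrt m = m := Real.mul_self_sqrt hmpos.le
  have hs0 : 0 < Real.sqrt m := Real.sqrt_pos.2 hmpos
  -- the double count of `Σ_π Σ_j Σ_x F(x) F(x ⊕ e_{π,j})`
  have hS := spectral_side hm1 (fun x => sgn (f x))
  have hCnt := counting_side (m := m) f
  have hsens : ∑ π : Fin n → Fin m, ∑ x : Fin n → Bool,
      ((univ.filter fun j : Fin m => f x ≠ f (fun i => xor (x i) (decide (π i = j)))).card : ℝ) ≤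
        (m : ℝ) ^ n * (B * (2 ^ n * Real.sqrt m)) := by
    calc _ ≤ ∑ _π : Fin n → Fin m, B * (2 ^ n * Real.sqrt m) := Finset.sum_le_sum fun π _ => hδ π
      _ = _ := by
        simp only [Finset.sum_const, Finset.card_univ, Fintype.card_fun, Fintype.card_fin,
          nsmul_eq_mul, Nat.cast_pow]
  have h1 : (m : ℝ) - 2 * (B * Real.sqrt m) ≤
      m * ∑ S : Finset (Fin n), cubeFourierCoeff (fun x => sgn (f x)) S ^ 2 * (1 - 2 / (m : ℝ)) ^ S.card := by
    have hK : (0 : ℝ) < 2 ^ n * (m : ℝ) ^ n := by positivity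
    refine le_of_mul_le_mul_left ?_ hK
    have key : (m : ℝ) ^ n * (m * 2 ^ n) - 2 * ((m : ℝ) ^ n * (B * (2 ^ n * Real.sqrt m))) ≤
        2 ^ n * (m : ℝ) ^ n * m *
          ∑ S : Finset (Fin n), cubeFourierCoeff (fun x => sgn (f x)) S ^ 2 * (1 - 2 / (m : ℝ)) ^ S.card := by
      rw [← hS, hCnt]
      linarith
    calc 2 ^ n * (m : ℝ) ^ n * ((m : ℝ) - 2 * (B * Real.sqrt m))
        = (m : ℝ) ^ n * (m * 2 ^ n) - 2 * ((m : ℝ) ^ n * (B * (2 ^ n * Real.sqrt m))) := by ring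
      _ ≤ _ := key
      _ = 2 ^ n * (m : ℝ) ^ n * (m * ∑ S : Finset (Fin n),
            cubeFourierCoeff (fun x => sgn (f x)) S ^ 2 * (1 - 2 / (m : ℝ)) ^ S.card) := by ring
  -- Parseval and the tail
  have hpar := sum_sq_coeff_sgn f
  have h2 : 2 / 3 * tailWeight (fun x => sgn (f x)) m ≤
      ∑ S : Finset (Fin n), (cubeFourierCoeff (fun x => sgn (f x)) S ^ 2 -
        cubeFourierCoeff (fun x => sgn (f x)) S ^ 2 * (1 - 2 / (m : ℝ)) ^ S.card) := by
    rw [tailWeight, Finset.mul_sum]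
    calc ∑ S ∈ univ.filter (fun S : Finset (Fin n) => m ≤ S.card),
          2 / 3 * cubeFourierCoeff (fun x => sgn (f x)) S ^ 2
        ≤ ∑ S ∈ univ.filter (fun S : Finset (Fin n) => m ≤ S.card),
            (cubeFourierCoeff (fun x => sgn (f x)) S ^ 2 -
              cubeFourierCoeff (fun x => sgn (f x)) S ^ 2 * (1 - 2 / (m : ℝ)) ^ S.card) := by
          refine Finset.sum_le_sum fun S hS => ?_
          simp only [Finset.mem_filter, Finset.mem_univ, true_and] at hS
          have hρS : (1 - 2 / (m : ℝ)) ^ S.card ≤ 1 / 3 :=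
            (pow_le_pow_of_le_one hρ0 hρ1 hS).trans hρm
          nlinarith [sq_nonneg (cubeFourierCoeff (fun x => sgn (f x)) S)]
      _ ≤ ∑ S, (cubeFourierCoeff (fun x => sgn (f x)) S ^ 2 -
            cubeFourierCoeff (fun x => sgn (f x)) S ^ 2 * (1 - 2 / (m : ℝ)) ^ S.card) := by
          refine Finset.sum_le_univ_sum_of_nonneg fun S => ?_
          have : (1 - 2 / (m : ℝ)) ^ S.card ≤ 1 := pow_le_one₀ hρ0 hρ1
          nlinarith [sq_nonneg (cubeFourierCoeff (fun x => sgn (f x)) S)]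
  rw [Finset.sum_sub_distrib, hpar] at h2
  -- the final arithmetic: `m - 2Bs ≤ mT`, `(2/3)tw ≤ 1 - T`, `s² = m` ⟹ `tw ≤ 3B/s`
  set tw := tailWeight (fun x => sgn (f x)) m with htw
  set T := ∑ S : Finset (Fin n),
    cubeFourierCoeff (fun x => sgn (f x)) S ^ 2 * (1 - 2 / (m : ℝ)) ^ S.card with hT
  rw [le_div_iff₀ hs0]
  have h3 : (m : ℝ) * tw ≤ 3 * B * Real.sqrt m := by nlinarith
  refine le_of_mul_le_mul_left ?_ hs0
  calc Real.sqrt m * (tw * Real.sqrt m) = (Real.sqrt m * Real.sqrt m) * tw := by ring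
    _ = m * tw := by rw [hs]
    _ ≤ 3 * B * Real.sqrt m := h3
    _ = Real.sqrt m * (3 * B) := by ring

open StubPeresTail in
/-- **Block sensitivity of a real linear threshold function.** For `f(x) = [θ ≤ Σ_i w_i x_i]` and
EVERY map `π : Fin n → Fin m` (a partition of the variables into `m` blocks), the number of pairs
(`x`, block `j`) such that flipping block `j` changes `f(x)` is at most `2ⁿ √m`. (Peres:
`σ ↦ f(x ⊕ π^*σ)` is a threshold function on `{0,1}^m`, whose total influence is `≤ √m` by
`stub_ltfInfluence`; average over the translates `x ⊕ π^*σ`.) -/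
theorem sens_ltf_le (w : Fin n → ℝ) (θ : ℝ) (π : Fin n → Fin m) :
    ∑ x : Fin n → Bool, ((univ.filter fun j : Fin m =>
        decide (θ ≤ ∑ i, w i * (if x i then (1 : ℝ) else 0)) ≠
          decide (θ ≤ ∑ i, w i * (if xor (x i) (decide (π i = j)) then (1 : ℝ) else 0))).card : ℝ)
      ≤ 2 ^ n * Real.sqrt m := by
  refine sum_le_of_translates π (fun y => ((univ.filter fun j : Fin m =>
      decide (θ ≤ ∑ i, w i * (if y i then (1 : ℝ) else 0)) ≠
        decide (θ ≤ ∑ i, w i * (if xor (y i) (decide (π i = j)) then (1 : ℝ) else 0))).card : ℝ))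
    (Real.sqrt m) fun x => ?_
  obtain ⟨W, Θ, hg⟩ := ltf_translate w θ π x
  have key : ∀ τ : Fin m → Bool, decide (Θ ≤ ∑ l, W l * (if τ l then (1 : ℝ) else 0)) =
      decide (θ ≤ ∑ i, w i * (if xor (x i) (τ (π i)) then (1 : ℝ) else 0)) :=
    fun τ => congrFun hg.symm τ
  have h1 := stub_ltfInfluence m W Θ
  simp_rw [key, xor_update_not] at h1
  exact h1

/-- **Block sensitivity of an integer linear threshold function**: the same bound for
`f(x) = [θ ≤ Σ_i w_i x_i]` with integer data (the form produced by the circuit structure lemmas). -/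
theorem sens_intLtf_le (w : Fin n → ℤ) (θ : ℤ) (π : Fin n → Fin m) :
    ∑ x : Fin n → Bool, ((univ.filter fun j : Fin m =>
        decide (θ ≤ ∑ i, w i * (if x i then (1 : ℤ) else 0)) ≠
          decide (θ ≤ ∑ i, w i * (if xor (x i) (decide (π i = j)) then (1 : ℤ) else 0))).card : ℝ)
      ≤ 2 ^ n * Real.sqrt m := by
  have h := sens_ltf_le (fun i => ((w i : ℤ) : ℝ)) (θ : ℝ) π
  simp only [← LtfCore.decide_intLtf_eq] at h
  exact h

end SensLtf

/-- **Registered stub `stub_tailOfSens`**: verbatim `SensLtf.tailWeight_le_of_sens_mul`. -/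
theorem stub_tailOfSens {n m : ℕ} (hm : 10 ≤ m) {B : ℝ} (f : (Fin n → Bool) → Bool) (hδ : ∀ π : Fin n → Fin m, ∑ x : Fin n → Bool, ((univ.filter fun j : Fin m => f x ≠ f (fun i => xor (x i) (decide (π i = j)))).card : ℝ) ≤ B * (2 ^ n * Real.sqrt m)) : tailWeight (fun x => sgn (f x)) m ≤ 3 * B / Real.sqrt m :=
  SensLtf.tailWeight_le_of_sens_mul hm f hδ

/-- **Registered stub `stub_sensLtf`**: verbatim `SensLtf.sens_intLtf_le`. -/
theorem stub_sensLtf {n m : ℕ} (w : Fin n → ℤ) (θ : ℤ) (π : Fin n → Fin m) : ∑ x : Fin n → Bool, ((univ.filter fun j : Fin m => decide (θ ≤ ∑ i, w i * (if x i then (1 : ℤ) else 0)) ≠ decide (θ ≤ ∑ i, w i * (if xor (x i) (decide (π i = j)) then (1 : ℤ) else 0))).card : ℝ) ≤ 2 ^ n * Real.sqrt m :=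
  SensLtf.sens_intLtf_le w θ π

end Summit.QuantumAdvantage.QuantumAdvantage.Theorems.LiouvilleOrthogonalTC0
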